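import Literature.AnabelianGeometry.AbsoluteAnabelian.AbsTopII.DatumOpenImmersionKernelLaw

/-!
# The kernel law for datum open immersions: elementary consequences (PROVED)

S. Mochizuki, *Topics in Absolute Anabelian Geometry I* [AbsTopI] (`MochizukiAbsTopI2012`), §4, Def 4.2
(i)(c) p. 48 / (iii)(c) p. 50, Remark 4.2.1 p. 51; [AbsTopII] (`MochizukiAbsTopII2013`) §3, Cor 3.7
pp. 72–73 (the "natural surjection `Π_{U_X} ↠ Π`").

PROOF-ONLY companion (no definition) of `AbsTopII/DatumOpenImmersionKernelLaw.lean` (abc-iut-L4-t6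
lineage, row «OPEN-IMM-KERNEL-LAW»).  For a datum model `M : EllipticDatumModel 𝒟` satisfying the mixin
`M.OpenImmersionKernelLaw` and a datum open immersion `ι : U → X` with representative `ψ` of `[π₁(ι)]`:
* `ker_le_geom` — `Ker ψ ⊆ Δ_U` (the generators `I_c = D_c ∩ Δ_U` lie in the closed normal subgroup
  `Δ_U`): `ψ` is injective on the Galois direction, as every homomorphism over `G` with "geometric"
  kernel;
* `ker_le_normalClosure_dcusp` — the hypothesis-shaped form used by abc-iut-f-064's
  `AbsTopII/BelyiCuspidalizationDatumSchemaScope.lean` (`Ker ψ ≤` the closure of the normal closure of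
  ALL cuspidal decomposition groups `D_c` of `U`), so its cusp-free deciders apply under the law;
* `injective_of_isEmpty_cusp` — no cusp of `U` recorded ⇒ `ψ` injective (with the surjectivity law:
  bijective, `bijective_of_isEmpty_cusp`) — the configuration of f-064's separation model is excluded.
HONEST FRAMING: consequences of a LAW of a model interface; typed ≠ proved for the law itself; nothing
here bears on [IUTchIII] Cor 3.12.
-/

open CategoryTheory Topology
open scoped Pointwise

universe u

namespace Literature.AnabelianGeometry.AbsoluteAnabelian.AbsTopII

open FundamentalExtension
open AbsTopI (ConstructionDataClass)
open AugmentedProfiniteGrp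

variable {𝒟 : ConstructionDataClass.{u}} {M : EllipticDatumModel 𝒟}

namespace EllipticDatumModel.OpenImmersionKernelLaw

variable (hK : M.OpenImmersionKernelLaw) {b : 𝒟.Base} {U X : (𝒟.datum b).Obj}
  (ι : (𝒟.datum b).Hom U X) (hι : M.IsOpenImmersion ι)
  (ψ : HomOver ((𝒟.datum b).grp U) ((𝒟.datum b).grp X)) (hψ : OuterHom.mk ψ = (𝒟.datum b).outerHom ι)

include hK hι hψ

/-- Under the kernel law, `Ker [π₁(ι)] ⊆ Δ_U`: the generating cuspidal decomposition groups
`I_c = D_c ∩ Δ_U` lie in the closed normal subgroup `Δ_U`. [cite: MochizukiAbsTopI2012, Def 4.2 (iii)(c) p.50] -/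
theorem ker_le_geom :
    (ψ.toHom.toMonoidHom.ker : Subgroup ((𝒟.datum b).ext U).arith) ≤ ((𝒟.datum b).ext U).geom := by
  obtain ⟨S, hS⟩ := hK.ker_eq ι hι ψ hψ
  rw [hS]
  refine Subgroup.topologicalClosure_minimal _ ?_ ((𝒟.datum b).ext U).isClosed_geom
  refine Subgroup.normalClosure_le_normal ?_
  intro x hx
  simp only [Set.mem_iUnion] at hx
  obtain ⟨c, -, hc⟩ := hx
  exact (M.cusps b U).Icusp_le_geom c hc

/-- Under the kernel law, `Ker [π₁(ι)]` lies in the closure of the normal closure of ALL the cuspidal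
decomposition groups `D_c` of `U` — the hypothesis shape of abc-iut-f-064's cusp-free deciders
(`BelyiCuspidalizationDatumSchemaScope.lean`: `NFOpen.ψ_injective_of_ker_le`,
`toBelyiModel_cor_3_7''_of_ker_le_of_isEmpty_cusp`, `toBelyiModel_cor_3_8_of_ker_le_of_isEmpty_cusp`).
[cite: MochizukiAbsTopI2012, Def 4.2 (iii)(c) p.50] -/
theorem ker_le_normalClosure_dcusp :
    (ψ.toHom.toMonoidHom.ker : Subgroup ((𝒟.datum b).ext U).arith) ≤
      (Subgroup.normalClosure (⋃ c : (M.cusps b U).Cusp,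
        ((M.cusps b U).Dcusp c : Set ((𝒟.datum b).ext U).arith))).topologicalClosure := by
  obtain ⟨S, hS⟩ := hK.ker_eq ι hι ψ hψ
  rw [hS]
  refine Subgroup.topologicalClosure_mono (Subgroup.normalClosure_mono ?_)
  intro x hx
  simp only [Set.mem_iUnion] at hx ⊢
  obtain ⟨c, -, hc⟩ := hx
  exact ⟨c, (M.cusps b U).Icusp_le_Dcusp c hc⟩

/-- Under the kernel law, an open immersion whose source has NO cusp recorded induces an INJECTIVE
`[π₁(ι)]` (every representative). [cite: MochizukiAbsTopI2012, Def 4.2 (iii)(c) p.50] -/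
theorem injective_of_isEmpty_cusp (hE : IsEmpty (M.cusps b U).Cusp) : Function.Injective ψ.toHom := by
  obtain ⟨S, hS⟩ := hK.ker_eq ι hι ψ hψ
  have hbot : Subgroup.normalClosure (⋃ c ∈ S,
      ((M.cusps b U).Icusp c : Set ((𝒟.datum b).ext U).arith)) ≤ ⊥ :=
    Subgroup.normalClosure_le_normal (by
      intro x hx
      simp only [Set.mem_iUnion] at hx
      obtain ⟨c, -, -⟩ := hx
      exact isEmptyElim c)
  have hcl : (Subgroup.normalClosure (⋃ c ∈ S,
      ((M.cusps b U).Icusp c : Set ((𝒟.datum b).ext U).arith))).topologicalClosure ≤ ⊥ :=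
    Subgroup.topologicalClosure_minimal _ hbot (by
      rw [Subgroup.coe_bot]
      exact isClosed_singleton)
  have h : ψ.toHom.toMonoidHom.ker = ⊥ := le_bot_iff.mp (hS.le.trans hcl)
  intro x y hxy
  exact (MonoidHom.ker_eq_bot_iff _).mp h hxy

/-- … hence, with `EllipticDatumModel`'s surjectivity law, a BIJECTIVE `[π₁(ι)]`: at cusp-free data an
open immersion of the datum is an isomorphism on fundamental groups (the configuration of the datum-level
separation model `BelyiDatumModel.exists_separation_model` — a non-injective "open immersion" with no
cusp recorded — is excluded by the law). [cite: MochizukiAbsTopI2012, Def 4.2 (iii)(c) p.50] -/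
theorem bijective_of_isEmpty_cusp (hE : IsEmpty (M.cusps b U).Cusp) : Function.Bijective ψ.toHom :=
  ⟨hK.injective_of_isEmpty_cusp ι hι ψ hψ hE, M.isOpenImmersion_surjective ι hι ψ hψ⟩

end EllipticDatumModel.OpenImmersionKernelLaw

end Literature.AnabelianGeometry.AbsoluteAnabelian.AbsTopII
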